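import Mathlib.Algebra.Lie.Killing
import Mathlib.Algebra.Lie.OfAssociative
import Mathlib.LinearAlgebra.Trace
import Mathlib.LinearAlgebra.FiniteDimensional.Lemmas
import Mathlib.Analysis.Complex.Basic
import HarnessLib

/-!
# The radical of `tr_W − ¾κ` on the derived algebra of a `2 ⊗ 3` MATRIX-UNIT SKELETON
# (`𝔊 = 𝔤𝔩₂ ⊗ 1 + 1 ⊗ 𝔤𝔩₃ ⊆ End(ℂ² ⊗ ℂ³)`): it is `𝔰𝔩₂ ⊗ 1`, non-zero and commuting with the `(2,4)`-involution
# `Θ = 1 ⊗ diag(1, −1, −1)` (Moonen–Zarhin 1999 (2.5); the arithmetic half of the `(2,4)` unitary core; classification-free)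

Family `hodge`, layer `Literature/AlgebraicGeometry/Motives` (pure complex linear algebra; no geometry; no Hodge theory).
Written for the cell `pub-hodgeav-hg6` (req-37 (A) row 2 «base of HC ladder», TABLE X row 8-`(4,2)`, crux
`UnitaryThetaCore.top_or_radical_two_four`; eng-5 lineage g5, brick V4; honest framing of that cell: HC / HC_AV / HC_CM / H2 NOT
proved — THIS file is unconditional linear algebra and discharges no hypothesis of the cell's cover). UNCONDITIONAL; theorems
only — no definition, no named fact (D-0026), no `sorry`.

SETTING (abstract; produced for the `(2,4)` unitary core by bricks V3 `UnitaryFourTwo.exists_matrix_units` and V3b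
`UnitaryFourTwo.exists_block_units`). `𝔊 ⊆ End(W)` closed under the commutator and containing two COMMUTING SYSTEMS OF MATRIX
UNITS: `p a b` (`a, b ∈ Fin 2`, `p_ab p_cd = δ_bc p_ad`, `p₀₀ + p₁₁ = 1`) and `u i j` (`i, j ∈ Fin 3`, `u_ij u_kl = δ_jk u_il`,
`u₀₀ + u₁₁ + u₂₂ = 1`), with `tr_W(p₀₀u₀₀) = 1` and `𝔊 = Σ ℂ p_ab + Σ ℂ u_ij`. So `W ≅ ℂ² ⊗ ℂ³` and
`𝔊 = 𝔤𝔩₂ ⊗ 1 + 1 ⊗ 𝔤𝔩₃`. The Lie bracket on `End(W)` is the commutator (`LieRing.ofAssociativeRing`, bound by `letI`).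

WHAT IS PROVED — **`UnitaryFourTwo.tensorSkeleton_radical`**: for every Lie subalgebra `𝔏 ⊆ End(W)` whose carrier is the span of
the commutators of `𝔊` (the derived algebra `𝔰𝔩₂ ⊗ 1 ⊕ 1 ⊗ 𝔰𝔩₃`), the element `Z = p₀₀ − p₁₁` is a NON-ZERO RADICAL VECTOR
of `Ψ = tr_W − ¾κ_𝔏` (`κ_𝔏` = Mathlib's `killingForm ℂ 𝔏`), and EVERY `Ψ`-radical vector commutes with
`T = u₀₀ − u₁₁ − u₂₂`. Values used: `tr_W(p_ab u_ij) = δ_ab δ_ij`; `κ(H,H) = 8` for `H = p₀₀ − p₁₁` and `κ(T′,T′) = 16` for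
the traceless `T′ = T + ⅓` (`(ad)²/4` is a projection, `LinearMap.IsProj.trace`); all other Killing values by INVARIANCE
(`LieModule.traceForm_apply_lie_apply'`) and WEIGHTS (`κ(x,y) = 0` when `[D,x] = λx`, `[D,y] = μy`, `λ + μ ≠ 0`):
`κ(u_ij, u_ji) = 6`, `κ(u_ij, u_lk) = 0` otherwise, `κ(𝔰𝔩₂ ⊗ 1, 1 ⊗ 𝔰𝔩₃) = 0`; on `𝔰𝔩₂ ⊗ 1`, `tr_W = 3·tr₂ = ¾κ`; a radical
vector `R = a + Σ c_ij u_ij` has `Ψ(R, u_lk) = (2 − ¾·6)c_kl`, so its off-diagonal `u`-coefficients vanish and `[R, T] = 0`.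
CONSUMER: brick V5 (`UnitaryThetaCore.top_or_radical_two_four`), then hg6's socket U1d → U1c → U1b → U1 (`hU` for `Lie Hg`).

## References
* [MoonenZarhin1999LowDim] B. Moonen, Yu. Zarhin, Math. Ann. 315 (1999), §2 (2.3), (2.5) (`𝔰𝔩₂ ⊗ 1 ⊕ 1 ⊗ 𝔰`; excluded
  arithmetically).
* [Humphreys1972] J. E. Humphreys, *Introduction to Lie Algebras and Representation Theory*, §5.1 (Killing form, invariance,
  `𝔰𝔩₂` example), §8.1 (root space decomposition: `κ(L_α, L_β) = 0` unless `α + β = 0`).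
* [Deligne1982HodgeCycles] P. Deligne, LNM 900 (1982), I §3 (the use: Hodge groups have no compact-type factor through which `h`
  is trivial — the consumer's radical kill).
-/

noncomputable section

open Module

namespace Literature.AlgebraicGeometry.Motives

namespace HodgeStructure

variable {W : Type*} [AddCommGroup W] [Module ℂ W]

/-! ### §1 Traces in a `2 ⊗ 3` matrix-unit skeleton -/

/-- **Traces in a `2 ⊗ 3` matrix-unit skeleton**: from `tr_W(p₀₀u₀₀) = 1` and the relations, `tr_W(p_ab u_ij) = δ_ab δ_ij`,
`tr_W(u_ij) = 2δ_ij`, `tr_W(p_ab) = 3δ_ab`, `tr_W(1) = 6`. [cite: Humphreys1972, §5.1] -/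
theorem UnitaryFourTwo.tensorSkeleton_traces [FiniteDimensional ℂ W]
    (p : Fin 2 → Fin 2 → Module.End ℂ W) (u : Fin 3 → Fin 3 → Module.End ℂ W)
    (hp : ∀ a b c d, p a b * p c d = if b = c then p a d else 0) (hpsum : p 0 0 + p 1 1 = 1)
    (hu : ∀ i j k l, u i j * u k l = if j = k then u i l else 0) (husum : u 0 0 + u 1 1 + u 2 2 = 1)
    (hcomm : ∀ a b i j, p a b * u i j = u i j * p a b) (htr : LinearMap.trace ℂ W (p 0 0 * u 0 0) = 1) :
    (∀ a b i j, LinearMap.trace ℂ W (p a b * u i j) = if a = b ∧ i = j then 1 else 0) ∧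
    (∀ i j, LinearMap.trace ℂ W (u i j) = if i = j then 2 else 0) ∧
    (∀ a b, LinearMap.trace ℂ W (p a b) = if a = b then 3 else 0) ∧
    LinearMap.trace ℂ W (1 : Module.End ℂ W) = 6 := by
  -- diagonal values: `tr(p_aa u_ii) = tr(p₀₀ u₀₀) = 1`
  have hdiag : ∀ a i, LinearMap.trace ℂ W (p a a * u i i) = 1 := by
    intro a i
    have h1 : LinearMap.trace ℂ W (p a a * u i i) = LinearMap.trace ℂ W (p 0 0 * u i i) := by
      have h : p a a = p a 0 * p 0 a := by rw [hp, if_pos rfl]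
      rw [h, mul_assoc, LinearMap.trace_mul_comm, mul_assoc, ← hcomm, ← mul_assoc, hp, if_pos rfl]
    have h2 : LinearMap.trace ℂ W (p 0 0 * u i i) = LinearMap.trace ℂ W (p 0 0 * u 0 0) := by
      have h : u i i = u i 0 * u 0 i := by rw [hu, if_pos rfl]
      rw [h, ← mul_assoc, LinearMap.trace_mul_comm, ← mul_assoc, ← hcomm, mul_assoc, hu, if_pos rfl]
    rw [h1, h2, htr]
  have hpu : ∀ a b i j, LinearMap.trace ℂ W (p a b * u i j) = if a = b ∧ i = j then 1 else 0 := by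
    intro a b i j
    by_cases hab : a = b
    · subst hab
      by_cases hij : i = j
      · subst hij; rw [if_pos ⟨rfl, rfl⟩, hdiag]
      · rw [if_neg (fun h => hij h.2)]
        have h : u i j = u i j * u j j := by rw [hu, if_pos rfl]
        rw [h, ← mul_assoc, LinearMap.trace_mul_comm, ← mul_assoc, ← hcomm, mul_assoc, hu, if_neg (Ne.symm hij),
          mul_zero, map_zero]
    · rw [if_neg (fun h => hab h.1)]
      have h : p a b = p a a * p a b := by rw [hp, if_pos rfl]
      rw [h, mul_assoc, LinearMap.trace_mul_comm, mul_assoc, ← hcomm, ← mul_assoc, hp, if_neg (Ne.symm hab), zero_mul,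
        map_zero]
  have htu : ∀ i j, LinearMap.trace ℂ W (u i j) = if i = j then 2 else 0 := by
    intro i j
    have h : u i j = p 0 0 * u i j + p 1 1 * u i j := by rw [← add_mul, hpsum, one_mul]
    rw [h, map_add, hpu, hpu]
    by_cases hij : i = j
    · simp [hij]; norm_num
    · simp [hij]
  have htp : ∀ a b, LinearMap.trace ℂ W (p a b) = if a = b then 3 else 0 := by
    intro a b
    have h : p a b = p a b * u 0 0 + p a b * u 1 1 + p a b * u 2 2 := by rw [← mul_add, ← mul_add, husum, mul_one]
    rw [h, map_add, map_add, hpu, hpu, hpu]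
    by_cases hab : a = b
    · simp [hab]; norm_num
    · simp [hab]
  refine ⟨hpu, htu, htp, ?_⟩
  rw [← husum, map_add, map_add, htu, htu, htu]
  norm_num

/-! ### §2 The radical of `tr_W − ¾κ` on the derived algebra -/

-- One long structural computation (the `𝔰𝔩₂ ⊕ 𝔰𝔩₃` bookkeeping); the budget below is per declaration.
set_option maxHeartbeats 1600000 in
/-- **THE RADICAL OF `tr_W − ¾κ` ON THE DERIVED ALGEBRA OF A `2 ⊗ 3` MATRIX-UNIT SKELETON.** (Module docstring.) For
`𝔊 = Σ ℂ p_ab + Σ ℂ u_ij` with commuting systems of `2 × 2` and `3 × 3` matrix units in `𝔊`, `tr_W(p₀₀u₀₀) = 1`, and every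
Lie subalgebra `𝔏` whose carrier is the span of the commutators of `𝔊`: `Z = p₀₀ − p₁₁ ∈ 𝔏` is non-zero,
`tr_W(ZY) = ¾κ_𝔏(Z,Y)` for all `Y ∈ 𝔏`, and every `R ∈ 𝔏` with `tr_W(RY) = ¾κ_𝔏(R,Y)` for all `Y` commutes with
`u₀₀ − u₁₁ − u₂₂`. [cite: MoonenZarhin1999LowDim, §2 (2.5)] [cite: Humphreys1972, §5.1 and §8.1] -/
theorem UnitaryFourTwo.tensorSkeleton_radical [FiniteDimensional ℂ W] {𝔊 : Submodule ℂ (Module.End ℂ W)}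
    (hbr : ∀ Y ∈ 𝔊, ∀ Z ∈ 𝔊, Y * Z - Z * Y ∈ 𝔊)
    (p : Fin 2 → Fin 2 → Module.End ℂ W) (u : Fin 3 → Fin 3 → Module.End ℂ W)
    (hp : ∀ a b c d, p a b * p c d = if b = c then p a d else 0) (hpsum : p 0 0 + p 1 1 = 1)
    (hu : ∀ i j k l, u i j * u k l = if j = k then u i l else 0) (husum : u 0 0 + u 1 1 + u 2 2 = 1)
    (hcomm : ∀ a b i j, p a b * u i j = u i j * p a b) (htr : LinearMap.trace ℂ W (p 0 0 * u 0 0) = 1)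
    (hp𝔊 : ∀ a b, p a b ∈ 𝔊) (hu𝔊 : ∀ i j, u i j ∈ 𝔊)
    (hG : ∀ X ∈ 𝔊, ∃ (s : Fin 2 → Fin 2 → ℂ) (c : Fin 3 → Fin 3 → ℂ),
      X = (∑ a, ∑ b, s a b • p a b) + ∑ i, ∑ j, c i j • u i j) :
    letI : LieRing (Module.End ℂ W) := LieRing.ofAssociativeRing
    ∀ 𝔏 : LieSubalgebra ℂ (Module.End ℂ W),
      𝔏.toSubmodule = Submodule.span ℂ {B | ∃ F ∈ 𝔊, ∃ G ∈ 𝔊, F * G - G * F = B} →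
      ∃ Z : 𝔏, Z ≠ 0 ∧
        (∀ Y : 𝔏, LinearMap.trace ℂ W ((Z : Module.End ℂ W) * (Y : Module.End ℂ W)) =
          (3 / 4 : ℂ) * killingForm ℂ 𝔏 Z Y) ∧
        ∀ R : 𝔏, (∀ Y : 𝔏, LinearMap.trace ℂ W ((R : Module.End ℂ W) * (Y : Module.End ℂ W)) =
            (3 / 4 : ℂ) * killingForm ℂ 𝔏 R Y) →
          (R : Module.End ℂ W) * (u 0 0 - u 1 1 - u 2 2) = (u 0 0 - u 1 1 - u 2 2) * (R : Module.End ℂ W) := by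
  letI : LieRing (Module.End ℂ W) := LieRing.ofAssociativeRing
  intro 𝔏 h𝔏
  classical
  obtain ⟨htrpu, htru, htrp, htr1⟩ := UnitaryFourTwo.tensorSkeleton_traces p u hp hpsum hu husum hcomm htr
  -- §A membership
  have hmem : ∀ x : Module.End ℂ W, x ∈ 𝔏 ↔ x ∈ Submodule.span ℂ {B | ∃ F ∈ 𝔊, ∃ G ∈ 𝔊, F * G - G * F = B} :=
    fun x => by rw [← LieSubalgebra.mem_toSubmodule, h𝔏]
  have hcm : ∀ F ∈ 𝔊, ∀ G ∈ 𝔊, F * G - G * F ∈ 𝔏 := fun F hF G hG' =>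
    (hmem _).2 (Submodule.subset_span ⟨F, hF, G, hG', rfl⟩)
  have h𝔏𝔊 : ∀ x : Module.End ℂ W, x ∈ 𝔏 → x ∈ 𝔊 := fun x hx => by
    have h := (hmem x).1 hx
    refine (Submodule.span_le.2 ?_) h
    rintro _ ⟨F, hF, G, hG', rfl⟩
    exact hbr F hF G hG'
  have htr𝔏 : ∀ x : Module.End ℂ W, x ∈ 𝔏 → LinearMap.trace ℂ W x = 0 := fun x hx => by
    have h := (hmem x).1 hx
    clear hx
    induction h using Submodule.span_induction with
    | mem y hy =>
      obtain ⟨F, -, G, -, rfl⟩ := hy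
      rw [map_sub, LinearMap.trace_mul_comm, sub_self]
    | zero => exact map_zero _
    | add y z _ _ hy hz => rw [map_add, hy, hz, add_zero]
    | smul c y _ hy => rw [map_smul, hy, smul_zero]
  have hbr𝔏 : ∀ x y : 𝔏, ((⁅x, y⁆ : 𝔏) : Module.End ℂ W) = (x : Module.End ℂ W) * y - y * x := fun x y => by
    rw [LieSubalgebra.coe_bracket, LieRing.of_associative_ring_bracket]
  -- §B units: short-hands
  have hpd : ∀ a, p a a * p a a = p a a := fun a => by rw [hp, if_pos rfl]
  have hud : ∀ i, u i i * u i i = u i i := fun i => by rw [hu, if_pos rfl]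
  have h01 : (0 : Fin 2) ≠ 1 := by decide
  have h10 : (1 : Fin 2) ≠ 0 := by decide
  -- the triple `H = p₀₀ − p₁₁`, `Ep = p₀₁`, `Fp = p₁₀`
  set H : Module.End ℂ W := p 0 0 - p 1 1 with hHdef
  set Ep : Module.End ℂ W := p 0 1 with hEpdef
  set Fp : Module.End ℂ W := p 1 0 with hFpdef
  have hEF : Ep * Fp - Fp * Ep = H := by rw [hEpdef, hFpdef, hp, hp, if_pos rfl, if_pos rfl]
  have hHE : H * Ep - Ep * H = (2 : ℂ) • Ep := by
    rw [hHdef, hEpdef, sub_mul, mul_sub, hp, hp, hp, hp, if_pos rfl, if_neg h10, if_neg h10, if_pos rfl, two_smul]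
    abel
  have hHF : H * Fp - Fp * H = -((2 : ℂ) • Fp) := by
    rw [hHdef, hFpdef, sub_mul, mul_sub, hp, hp, hp, hp, if_neg h01, if_pos rfl, if_pos rfl, if_neg h01, two_smul]
    abel
  have hHH : H * H = 1 := by
    rw [hHdef, sub_mul, mul_sub, mul_sub, hp, hp, hp, hp, if_pos rfl, if_neg h01, if_neg h10, if_pos rfl, ← hpsum]
    abel
  have hHEm : H * Ep = Ep := by rw [hHdef, hEpdef, sub_mul, hp, hp, if_pos rfl, if_neg h10, sub_zero]
  have hHFm : H * Fp = -Fp := by rw [hHdef, hFpdef, sub_mul, hp, hp, if_neg h01, if_pos rfl, zero_sub]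
  have hH𝔏 : H ∈ 𝔏 := by rw [← hEF]; exact hcm _ (hp𝔊 0 1) _ (hp𝔊 1 0)
  have hEp𝔏 : Ep ∈ 𝔏 := by
    have h : p 0 0 * p 0 1 - p 0 1 * p 0 0 = Ep := by rw [hp, hp, if_pos rfl, if_neg h10, sub_zero]
    rw [← h]; exact hcm _ (hp𝔊 0 0) _ (hp𝔊 0 1)
  have hFp𝔏 : Fp ∈ 𝔏 := by
    have h : p 1 1 * p 1 0 - p 1 0 * p 1 1 = Fp := by rw [hp, hp, if_pos rfl, if_neg h01, sub_zero]
    rw [← h]; exact hcm _ (hp𝔊 1 1) _ (hp𝔊 1 0)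
  have hu𝔏 : ∀ i j, i ≠ j → u i j ∈ 𝔏 := fun i j hij => by
    have h : u i i * u i j - u i j * u i i = u i j := by rw [hu, hu, if_pos rfl, if_neg (Ne.symm hij), sub_zero]
    rw [← h]; exact hcm _ (hu𝔊 i i) _ (hu𝔊 i j)
  have hd𝔏 : ∀ i j, i ≠ j → u i i - u j j ∈ 𝔏 := fun i j hij => by
    have h : u i j * u j i - u j i * u i j = u i i - u j j := by rw [hu, hu, if_pos rfl, if_pos rfl]
    rw [← h]; exact hcm _ (hu𝔊 i j) _ (hu𝔊 j i)
  -- §C structure of `𝔏`: `z = αH + βEp + γFp + Σ c_ij u_ij` with `Σ c_ii = 0`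
  have hstruct : ∀ z : Module.End ℂ W, z ∈ 𝔏 → ∃ α β γ : ℂ, ∃ c : Fin 3 → Fin 3 → ℂ,
      z = α • H + β • Ep + γ • Fp + ∑ i, ∑ j, c i j • u i j ∧ ∑ i, c i i = 0 := by
    intro z hz
    obtain ⟨s, c, hz'⟩ := hG z (h𝔏𝔊 z hz)
    set σ : ℂ := (2 : ℂ)⁻¹ * (s 0 0 + s 1 1) with hσ
    refine ⟨(2 : ℂ)⁻¹ * (s 0 0 - s 1 1), s 0 1, s 1 0, fun i j => c i j + if i = j then σ else 0, ?_, ?_⟩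
    · have hps : ∑ a, ∑ b, s a b • p a b = ((2 : ℂ)⁻¹ * (s 0 0 - s 1 1)) • H + s 0 1 • Ep + s 1 0 • Fp + σ • 1 := by
        rw [Fin.sum_univ_two, Fin.sum_univ_two, Fin.sum_univ_two, hHdef, hEpdef, hFpdef, ← hpsum, hσ]
        module
      have hus : ∑ i, ∑ j, (c i j + if i = j then σ else 0) • u i j = (∑ i, ∑ j, c i j • u i j) + σ • 1 := by
        simp only [add_smul, Finset.sum_add_distrib, ite_smul, zero_smul, Finset.sum_ite_eq, Finset.mem_univ, if_true,
          ← husum, Fin.sum_univ_three, smul_add]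
      rw [hz', hps, hus]
      abel
    · -- tracelessness
      have htrz := htr𝔏 z hz
      rw [hz'] at htrz
      simp only [map_add, map_smul, htrp, htru, smul_eq_mul, Fin.sum_univ_two, Fin.sum_univ_three] at htrz
      simp only [Fin.sum_univ_three]
      rw [hσ]
      simp only [Fin.isValue, if_true, show (0 : Fin 2) ≠ 1 from by decide, show (1 : Fin 2) ≠ 0 from by decide,
        show (0 : Fin 3) ≠ 1 from by decide, show (0 : Fin 3) ≠ 2 from by decide, show (1 : Fin 3) ≠ 0 from by decide,
        show (1 : Fin 3) ≠ 2 from by decide, show (2 : Fin 3) ≠ 0 from by decide, show (2 : Fin 3) ≠ 1 from by decide,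
        if_false, mul_zero, add_zero, zero_add] at htrz ⊢
      -- htrz : s00*3 + s11*3 + (c00*2 + c11*2 + c22*2) = 0 (up to normal form)
      linear_combination (2 : ℂ)⁻¹ * htrz
  -- §D non-vanishing and independence facts
  have hu0 : ∀ i j, u i j ≠ 0 := fun i j h0 => by
    have h : u i i = 0 := by rw [← show u i j * u j i = u i i by rw [hu, if_pos rfl], h0, zero_mul]
    have h1 := htrpu 0 0 i i
    rw [if_pos ⟨rfl, rfl⟩, h, mul_zero, map_zero] at h1
    exact zero_ne_one h1
  have hp0 : ∀ a b, p a b ≠ 0 := fun a b h0 => by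
    have h : p a a = 0 := by rw [← show p a b * p b a = p a a by rw [hp, if_pos rfl], h0, zero_mul]
    have h1 := htrpu a a 0 0
    rw [if_pos ⟨rfl, rfl⟩, h, zero_mul, map_zero] at h1
    exact zero_ne_one h1
  -- diagonal operators `diag r = Σ r_k u_kk` and their brackets with the units
  have hdiagL : ∀ (r : Fin 3 → ℂ) i j, (∑ k, r k • u k k) * u i j = r i • u i j := fun r i j => by
    rw [Finset.sum_mul]
    simp only [smul_mul_assoc, hu, smul_ite, smul_zero, Finset.sum_ite_eq', Finset.mem_univ, if_true]
  have hdiagR : ∀ (r : Fin 3 → ℂ) i j, u i j * (∑ k, r k • u k k) = r j • u i j := fun r i j => by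
    rw [Finset.mul_sum]
    simp only [mul_smul_comm, hu, smul_ite, smul_zero, Finset.sum_ite_eq, Finset.mem_univ, if_true]
  have hdiagp : ∀ (r : Fin 3 → ℂ) a b, (∑ k, r k • u k k) * p a b = p a b * ∑ k, r k • u k k := fun r a b => by
    rw [Finset.sum_mul, Finset.mul_sum]
    simp only [smul_mul_assoc, mul_smul_comm, hcomm]
  -- the two gradings: `t = (4/3, −2/3, −2/3)` (`T′ = T + ⅓`) and `s = (0, 1, −1)`
  set t : Fin 3 → ℂ := ![4 / 3, -2 / 3, -2 / 3] with htdef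
  set sv : Fin 3 → ℂ := ![0, 1, -1] with hsvdef
  have ht0 : t 0 = 4 / 3 := rfl
  have ht1 : t 1 = -2 / 3 := rfl
  have ht2 : t 2 = -2 / 3 := rfl
  have hs0 : sv 0 = 0 := rfl
  have hs1 : sv 1 = 1 := rfl
  have hs2 : sv 2 = -1 := rfl
  set Td : Module.End ℂ W := ∑ k, t k • u k k with hTddef
  set Sd : Module.End ℂ W := ∑ k, sv k • u k k with hSddef
  have hTdeq : Td = (4 / 3 : ℂ) • (u 0 0 - u 1 1) + (2 / 3 : ℂ) • (u 1 1 - u 2 2) := by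
    rw [hTddef, Fin.sum_univ_three, ht0, ht1, ht2]; module
  have hSdeq : Sd = u 1 1 - u 2 2 := by
    rw [hSddef, Fin.sum_univ_three, hs0, hs1, hs2]; module
  have h01' : (0 : Fin 3) ≠ 1 := by decide
  have h02' : (0 : Fin 3) ≠ 2 := by decide
  have h12' : (1 : Fin 3) ≠ 2 := by decide
  have hTd𝔏 : Td ∈ 𝔏 := by
    rw [hTdeq]
    exact add_mem (𝔏.smul_mem _ (hd𝔏 0 1 h01')) (𝔏.smul_mem _ (hd𝔏 1 2 h12'))
  have hSd𝔏 : Sd ∈ 𝔏 := by rw [hSdeq]; exact hd𝔏 1 2 h12'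
  -- §E the Killing form: elements of `𝔏`, weights, invariance
  set κ := killingForm ℂ 𝔏 with hκdef
  have hinv : ∀ x y z : 𝔏, κ ⁅x, y⁆ z = -κ y ⁅x, z⁆ := fun x y z => LieModule.traceForm_apply_lie_apply' ℂ 𝔏 𝔏 x y z
  have hsymm : ∀ x y : 𝔏, κ x y = κ y x := fun x y => LieModule.traceForm_comm ℂ 𝔏 𝔏 x y
  have hweight : ∀ (D x y : 𝔏) (l m : ℂ), ⁅D, x⁆ = l • x → ⁅D, y⁆ = m • y → l + m ≠ 0 → κ x y = 0 := by
    intro D x y l m hx hy hlm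
    have h := hinv D x y
    rw [hx, hy, map_smul, LinearMap.smul_apply, smul_eq_mul, map_smul, smul_eq_mul] at h
    have h2 : (l + m) * κ x y = 0 := by rw [add_mul, h]; ring
    exact (mul_eq_zero.1 h2).resolve_left hlm
  -- named elements of `𝔏`
  set H' : 𝔏 := ⟨H, hH𝔏⟩ with hH'def
  set E' : 𝔏 := ⟨Ep, hEp𝔏⟩ with hE'def
  set F' : 𝔏 := ⟨Fp, hFp𝔏⟩ with hF'def
  set T' : 𝔏 := ⟨Td, hTd𝔏⟩ with hT'def
  set S' : 𝔏 := ⟨Sd, hSd𝔏⟩ with hS'def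
  set u01 : 𝔏 := ⟨u 0 1, hu𝔏 0 1 h01'⟩ with hu01def
  set u02 : 𝔏 := ⟨u 0 2, hu𝔏 0 2 h02'⟩ with hu02def
  set u10 : 𝔏 := ⟨u 1 0, hu𝔏 1 0 h01'.symm⟩ with hu10def
  set u12 : 𝔏 := ⟨u 1 2, hu𝔏 1 2 h12'⟩ with hu12def
  set u20 : 𝔏 := ⟨u 2 0, hu𝔏 2 0 h02'.symm⟩ with hu20def
  set u21 : 𝔏 := ⟨u 2 1, hu𝔏 2 1 h12'.symm⟩ with hu21def
  set d02 : 𝔏 := ⟨u 0 0 - u 2 2, hd𝔏 0 2 h02'⟩ with hd02def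
  set d12 : 𝔏 := ⟨u 1 1 - u 2 2, hd𝔏 1 2 h12'⟩ with hd12def
  set d01 : 𝔏 := ⟨u 0 0 - u 1 1, hd𝔏 0 1 h01'⟩ with hd01def
  -- brackets with the gradings
  have hTu : ∀ (i j : Fin 3) (hij : u i j ∈ 𝔏), ⁅T', (⟨u i j, hij⟩ : 𝔏)⁆ = (t i - t j) • (⟨u i j, hij⟩ : 𝔏) :=
    fun i j hij => Subtype.ext (by
      rw [hbr𝔏]
      change Td * u i j - u i j * Td = (t i - t j) • u i j
      rw [hTddef, hdiagL, hdiagR, sub_smul])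
  have hSu : ∀ (i j : Fin 3) (hij : u i j ∈ 𝔏), ⁅S', (⟨u i j, hij⟩ : 𝔏)⁆ = (sv i - sv j) • (⟨u i j, hij⟩ : 𝔏) :=
    fun i j hij => Subtype.ext (by
      rw [hbr𝔏]
      change Sd * u i j - u i j * Sd = (sv i - sv j) • u i j
      rw [hSddef, hdiagL, hdiagR, sub_smul])
  have hdiagdiag : ∀ (r : Fin 3 → ℂ) a b, (∑ k, r k • u k k) * (u a a - u b b) = (u a a - u b b) * ∑ k, r k • u k k :=
    fun r a b => by rw [mul_sub, sub_mul, hdiagL, hdiagL, hdiagR, hdiagR]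
  have hTd : ∀ (a b : Fin 3) (hab : u a a - u b b ∈ 𝔏), ⁅T', (⟨u a a - u b b, hab⟩ : 𝔏)⁆ = (0 : ℂ) • ⟨u a a - u b b, hab⟩ :=
    fun a b hab => Subtype.ext (by
      rw [hbr𝔏, zero_smul]
      change Td * (u a a - u b b) - (u a a - u b b) * Td = 0
      rw [hTddef, hdiagdiag, sub_self])
  -- `κ(a, b) = 0` for `a ∈ {H, Ep, Fp}` and `b ∈ 𝔏` commuting with all `p c d`
  have hpcomm_struct : ∀ (a : Module.End ℂ W), (∀ i j, a * u i j = u i j * a) → ∀ (b : Module.End ℂ W),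
      (∀ c d, b * p c d = p c d * b) → a * b = b * a → ∀ z : Module.End ℂ W, z ∈ 𝔏 →
      a * (b * z - z * b) - (b * z - z * b) * a = 0 := by
    intro a hau b hbp hab z hz
    obtain ⟨α, β, γ, c, hz', -⟩ := hstruct z hz
    have hbH : b * H = H * b := by rw [hHdef, mul_sub, sub_mul, hbp, hbp]
    have hbE : b * Ep = Ep * b := hbp 0 1
    have hbF : b * Fp = Fp * b := hbp 1 0
    have hbS : b * z - z * b = b * (∑ i, ∑ j, c i j • u i j) - (∑ i, ∑ j, c i j • u i j) * b := by
      rw [hz', mul_add, mul_add, mul_add, add_mul, add_mul, add_mul, mul_smul_comm, mul_smul_comm, mul_smul_comm,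
        smul_mul_assoc, smul_mul_assoc, smul_mul_assoc, hbH, hbE, hbF]
      abel
    have haS : a * (∑ i, ∑ j, c i j • u i j) = (∑ i, ∑ j, c i j • u i j) * a := by
      rw [Finset.mul_sum, Finset.sum_mul]
      refine Finset.sum_congr rfl fun i _ => ?_
      rw [Finset.mul_sum, Finset.sum_mul]
      refine Finset.sum_congr rfl fun j _ => ?_
      rw [mul_smul_comm, smul_mul_assoc, hau]
    set S := ∑ i, ∑ j, c i j • u i j with hSdef'
    rw [hbS]
    calc a * (b * S - S * b) - (b * S - S * b) * a
        = (a * b) * S - (a * S) * b - b * (S * a) + S * (b * a) := by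
          simp only [mul_sub, sub_mul, mul_assoc]; abel
      _ = 0 := by rw [hab, haS, mul_assoc, haS, mul_assoc, hab, ← mul_assoc, ← mul_assoc]; abel
  have hκab : ∀ (a b : 𝔏), (∀ i j, (a : Module.End ℂ W) * u i j = u i j * a) →
      (∀ c d, (b : Module.End ℂ W) * p c d = p c d * b) → (a : Module.End ℂ W) * b = b * a → κ a b = 0 := by
    intro a b hau hbp hab
    rw [hκdef, killingForm_apply_apply]
    have h0 : LieAlgebra.ad ℂ 𝔏 a ∘ₗ LieAlgebra.ad ℂ 𝔏 b = 0 := by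
      refine LinearMap.ext fun z => Subtype.ext ?_
      rw [LinearMap.comp_apply, LieAlgebra.ad_apply, LieAlgebra.ad_apply, hbr𝔏, hbr𝔏, LinearMap.zero_apply]
      exact hpcomm_struct a hau b hbp hab z z.2
    rw [h0, map_zero]
  have hHu : ∀ i j, H * u i j = u i j * H := fun i j => by rw [hHdef, sub_mul, mul_sub, hcomm, hcomm]
  have hEu : ∀ i j, Ep * u i j = u i j * Ep := fun i j => hcomm 0 1 i j
  have hFu : ∀ i j, Fp * u i j = u i j * Fp := fun i j => hcomm 1 0 i j
  have hup : ∀ i j c d, u i j * p c d = p c d * u i j := fun i j c d => (hcomm c d i j).symm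
  have hdp : ∀ a b c d, (u a a - u b b) * p c d = p c d * (u a a - u b b) := fun a b c d => by
    rw [sub_mul, mul_sub, hup, hup]
  -- §F the `𝔰𝔩₂`-triple inside `𝔏`
  have hEpH : Ep * H = -Ep := by
    have h : Ep * H = H * Ep - (2 : ℂ) • Ep := by rw [← hHE]; abel
    rw [h, hHEm, two_smul]; abel
  have hFpH : Fp * H = Fp := by
    have h : Fp * H = H * Fp + (2 : ℂ) • Fp := by rw [← neg_neg ((2 : ℂ) • Fp), ← hHF]; abel
    rw [h, hHFm, two_smul]; abel
  have hHE' : ⁅H', E'⁆ = (2 : ℂ) • E' := Subtype.ext (by rw [hbr𝔏]; exact hHE)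
  have hHF' : ⁅H', F'⁆ = (-2 : ℂ) • F' := Subtype.ext (by
    rw [hbr𝔏]; change H * Fp - Fp * H = (-2 : ℂ) • Fp; rw [hHF, neg_smul])
  have hEF' : ⁅E', F'⁆ = H' := Subtype.ext (by rw [hbr𝔏]; exact hEF)
  have hHH' : ⁅H', H'⁆ = (0 : ℂ) • H' := by rw [lie_self, zero_smul]
  have hκHE : κ H' E' = 0 := hweight H' H' E' 0 2 hHH' hHE' (by norm_num)
  have hκHF : κ H' F' = 0 := hweight H' H' F' 0 (-2) hHH' hHF' (by norm_num)
  have hκEE : κ E' E' = 0 := hweight H' E' E' 2 2 hHE' hHE' (by norm_num)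
  have hκFF : κ F' F' = 0 := hweight H' F' F' (-2) (-2) hHF' hHF' (by norm_num)
  have hκHH_EF : κ H' H' = 2 * κ E' F' := by
    have h := hinv E' F' H'
    rw [hEF', ← lie_skew E' H', hHE', map_neg, map_smul, smul_eq_mul] at h
    rw [h, hsymm F' E']; ring
  -- §G `κ(H,H) = 8`: `(ad H)² = 4·π` with `π` the projection onto `span{E', F'}`
  have hS_H : ∀ S : Module.End ℂ W, S * H = H * S → ∀ α β γ : ℂ,
      H * (H * (α • H + β • Ep + γ • Fp + S) - (α • H + β • Ep + γ • Fp + S) * H) -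
        (H * (α • H + β • Ep + γ • Fp + S) - (α • H + β • Ep + γ • Fp + S) * H) * H =
      (4 : ℂ) • (β • Ep + γ • Fp) := by
    intro S hSH α β γ
    have hD : H * (α • H + β • Ep + γ • Fp + S) - (α • H + β • Ep + γ • Fp + S) * H =
        (2 : ℂ) • (β • Ep) - (2 : ℂ) • (γ • Fp) := by
      simp only [mul_add, add_mul, mul_smul_comm, smul_mul_assoc, hHH, hHEm, hHFm, hEpH, hFpH, hSH]
      module
    rw [hD]
    simp only [mul_sub, sub_mul, mul_smul_comm, smul_mul_assoc, hHEm, hHFm, hEpH, hFpH]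
    module
  have husumH : ∀ (c : Fin 3 → Fin 3 → ℂ), (∑ i, ∑ j, c i j • u i j) * H = H * ∑ i, ∑ j, c i j • u i j := by
    intro c
    rw [Finset.sum_mul, Finset.mul_sum]
    refine Finset.sum_congr rfl fun i _ => ?_
    rw [Finset.sum_mul, Finset.mul_sum]
    refine Finset.sum_congr rfl fun j _ => ?_
    rw [smul_mul_assoc, mul_smul_comm, hHu]
  have hliEF : LinearIndependent ℂ ![E', F'] := by
    refine LinearIndependent.pair_iff.2 fun a b hab => ?_
    have h := congrArg Subtype.val hab
    change a • Ep + b • Fp = 0 at h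
    have h1 := congrArg (fun X => p 0 0 * X) h
    simp only [mul_add, mul_smul_comm, mul_zero, hEpdef, hFpdef, hp, if_neg h01, smul_zero, add_zero] at h1
    have h2 := congrArg (fun X => p 1 1 * X) h
    simp only [mul_add, mul_smul_comm, mul_zero, hEpdef, hFpdef, hp, if_neg h10, smul_zero, zero_add] at h2
    exact ⟨(smul_eq_zero.1 h1).resolve_right (hp0 0 1), (smul_eq_zero.1 h2).resolve_right (hp0 1 0)⟩
  set S₂ : Submodule ℂ 𝔏 := Submodule.span ℂ (Set.range ![E', F']) with hS₂def
  have hfinS₂ : finrank ℂ S₂ = 2 := by rw [hS₂def, finrank_span_eq_card hliEF]; simp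
  have hκHH : κ H' H' = 8 := by
    set A : 𝔏 →ₗ[ℂ] 𝔏 := LieAlgebra.ad ℂ 𝔏 H' ∘ₗ LieAlgebra.ad ℂ 𝔏 H' with hAdef
    have hAval : ∀ z : 𝔏, ∃ β γ : ℂ, A z = (4 : ℂ) • (β • E' + γ • F') := by
      intro z
      obtain ⟨α, β, γ, c, hz, -⟩ := hstruct z z.2
      refine ⟨β, γ, Subtype.ext ?_⟩
      rw [hAdef, LinearMap.comp_apply, LieAlgebra.ad_apply, LieAlgebra.ad_apply, hbr𝔏, hbr𝔏]
      change H * (H * (z : Module.End ℂ W) - z * H) - (H * z - z * H) * H = ((4 : ℂ) • (β • E' + γ • F') : 𝔏)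
      rw [hz]
      exact hS_H _ (husumH c) α β γ
    have hproj : LinearMap.IsProj S₂ ((4 : ℂ)⁻¹ • A) := by
      constructor
      · intro z
        obtain ⟨β, γ, hβγ⟩ := hAval z
        rw [LinearMap.smul_apply, hβγ, smul_smul, inv_mul_cancel₀ (by norm_num : (4 : ℂ) ≠ 0), one_smul]
        exact Submodule.add_mem _ (Submodule.smul_mem _ _ (Submodule.subset_span ⟨0, rfl⟩))
          (Submodule.smul_mem _ _ (Submodule.subset_span ⟨1, rfl⟩))
      · intro z hz
        obtain ⟨cf, hcf⟩ := (Submodule.mem_span_range_iff_exists_fun ℂ).1 hz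
        rw [Fin.sum_univ_two] at hcf
        have hzval : (z : Module.End ℂ W) = (0 : ℂ) • H + cf 0 • Ep + cf 1 • Fp + 0 := by
          rw [← hcf]; simp [hE'def, hF'def]
        have hAz : A z = (4 : ℂ) • (cf 0 • E' + cf 1 • F') := Subtype.ext (by
          rw [hAdef, LinearMap.comp_apply, LieAlgebra.ad_apply, LieAlgebra.ad_apply, hbr𝔏, hbr𝔏]
          change H * (H * (z : Module.End ℂ W) - z * H) - (H * z - z * H) * H = ((4 : ℂ) • (cf 0 • E' + cf 1 • F') : 𝔏)
          rw [hzval]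
          exact hS_H 0 (by rw [zero_mul, mul_zero]) 0 (cf 0) (cf 1))
        rw [LinearMap.smul_apply, hAz, smul_smul, inv_mul_cancel₀ (by norm_num : (4 : ℂ) ≠ 0), one_smul, ← hcf]
        simp
    have htrA : LinearMap.trace ℂ 𝔏 A = 8 := by
      have h := hproj.trace
      rw [map_smul, hfinS₂, smul_eq_mul] at h
      have h' : LinearMap.trace ℂ 𝔏 A = 4 * ((4 : ℂ)⁻¹ * LinearMap.trace ℂ 𝔏 A) := by
        rw [← mul_assoc, mul_inv_cancel₀ (by norm_num : (4 : ℂ) ≠ 0), one_mul]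
      rw [h', h]; norm_num
    rw [hκdef, killingForm_apply_apply]
    exact htrA
  have hκEF : κ E' F' = 4 := by
    have h := hκHH_EF; rw [hκHH] at h
    linear_combination -(1 / 2 : ℂ) * h
  -- §H `κ(T′,T′) = 16`: `(ad T′)² = 4·π` with `π` the projection onto `span{u₀₁, u₀₂, u₁₀, u₂₀}`
  have hdiagsum : ∀ (r : Fin 3 → ℂ) (c : Fin 3 → Fin 3 → ℂ),
      (∑ k, r k • u k k) * (∑ i, ∑ j, c i j • u i j) - (∑ i, ∑ j, c i j • u i j) * (∑ k, r k • u k k) =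
        ∑ i, ∑ j, (c i j * (r i - r j)) • u i j := by
    intro r c
    rw [Finset.mul_sum, Finset.sum_mul, ← Finset.sum_sub_distrib]
    refine Finset.sum_congr rfl fun i _ => ?_
    rw [Finset.mul_sum, Finset.sum_mul, ← Finset.sum_sub_distrib]
    refine Finset.sum_congr rfl fun j _ => ?_
    rw [mul_smul_comm, smul_mul_assoc, hdiagL, hdiagR, smul_smul, smul_smul, ← sub_smul, ← mul_sub]
  have hTdH : Td * H = H * Td := by rw [hHdef, mul_sub, sub_mul, hTddef, hdiagp, hdiagp]
  have hTdE : Td * Ep = Ep * Td := by rw [hTddef, hdiagp]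
  have hTdF : Td * Fp = Fp * Td := by rw [hTddef, hdiagp]
  have hTdX : ∀ (α β γ : ℂ) (c : Fin 3 → Fin 3 → ℂ),
      Td * (Td * (α • H + β • Ep + γ • Fp + ∑ i, ∑ j, c i j • u i j) -
        (α • H + β • Ep + γ • Fp + ∑ i, ∑ j, c i j • u i j) * Td) -
      (Td * (α • H + β • Ep + γ • Fp + ∑ i, ∑ j, c i j • u i j) -
        (α • H + β • Ep + γ • Fp + ∑ i, ∑ j, c i j • u i j) * Td) * Td =
      ∑ i, ∑ j, (c i j * (t i - t j) * (t i - t j)) • u i j := by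
    intro α β γ c
    have h1 : Td * (α • H + β • Ep + γ • Fp + ∑ i, ∑ j, c i j • u i j) -
        (α • H + β • Ep + γ • Fp + ∑ i, ∑ j, c i j • u i j) * Td = ∑ i, ∑ j, (c i j * (t i - t j)) • u i j := by
      rw [← hdiagsum t c, ← hTddef]
      simp only [mul_add, add_mul, mul_smul_comm, smul_mul_assoc, hTdH, hTdE, hTdF]
      abel
    rw [h1, hTddef, hdiagsum]
  have hTdX' : ∀ (α β γ : ℂ) (c : Fin 3 → Fin 3 → ℂ),
      ∑ i, ∑ j, (c i j * (t i - t j) * (t i - t j)) • u i j =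
        (4 : ℂ) • (c 0 1 • u 0 1 + c 0 2 • u 0 2 + c 1 0 • u 1 0 + c 2 0 • u 2 0) := by
    intro α β γ c
    simp only [Fin.sum_univ_three, ht0, ht1, ht2]
    norm_num
    module
  -- linear independence of `u₀₁, u₀₂, u₁₀, u₂₀` (in `𝔏`)
  have hli4 : LinearIndependent ℂ ![u01, u02, u10, u20] := by
    rw [Fintype.linearIndependent_iff]
    intro g hg
    have h := congrArg Subtype.val hg
    rw [Fin.sum_univ_four] at h
    change g 0 • u 0 1 + g 1 • u 0 2 + g 2 • u 1 0 + g 3 • u 2 0 = 0 at h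
    have key : ∀ (a b : Fin 3), u a a * (g 0 • u 0 1 + g 1 • u 0 2 + g 2 • u 1 0 + g 3 • u 2 0) * u b b = 0 := by
      intro a b; rw [h, mul_zero, zero_mul]
    have e0 := key 0 1
    have e1 := key 0 2
    have e2 := key 1 0
    have e3 := key 2 0
    simp only [mul_add, add_mul, mul_smul_comm, smul_mul_assoc, hu, Fin.isValue, if_true,
      show (0 : Fin 3) ≠ 1 from by decide, show (0 : Fin 3) ≠ 2 from by decide,
      show (1 : Fin 3) ≠ 0 from by decide, show (1 : Fin 3) ≠ 2 from by decide, show (2 : Fin 3) ≠ 0 from by decide,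
      show (2 : Fin 3) ≠ 1 from by decide, if_false, smul_zero, add_zero, zero_add] at e0 e1 e2 e3
    intro m
    fin_cases m
    · exact (smul_eq_zero.1 e0).resolve_right (hu0 0 1)
    · exact (smul_eq_zero.1 e1).resolve_right (hu0 0 2)
    · exact (smul_eq_zero.1 e2).resolve_right (hu0 1 0)
    · exact (smul_eq_zero.1 e3).resolve_right (hu0 2 0)
  set S₄ : Submodule ℂ 𝔏 := Submodule.span ℂ (Set.range ![u01, u02, u10, u20]) with hS₄def
  have hfinS₄ : finrank ℂ S₄ = 4 := by rw [hS₄def, finrank_span_eq_card hli4]; simp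
  have hmS : ∀ m : Fin 4, (![u01, u02, u10, u20] m) ∈ S₄ := fun m => Submodule.subset_span ⟨m, rfl⟩
  have hm0 : u01 ∈ S₄ := hmS 0
  have hm1 : u02 ∈ S₄ := hmS 1
  have hm2 : u10 ∈ S₄ := hmS 2
  have hm3 : u20 ∈ S₄ := hmS 3
  have hAA : ∀ (i j : Fin 3) (hij : u i j ∈ 𝔏),
      ⁅T', ⁅T', (⟨u i j, hij⟩ : 𝔏)⁆⁆ = ((t i - t j) * (t i - t j)) • (⟨u i j, hij⟩ : 𝔏) := by
    intro i j hij; rw [hTu, lie_smul, hTu, smul_smul]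
  have hA01 : ⁅T', ⁅T', u01⁆⁆ = (4 : ℂ) • u01 := by rw [hu01def, hAA, ht0, ht1]; norm_num
  have hA02 : ⁅T', ⁅T', u02⁆⁆ = (4 : ℂ) • u02 := by rw [hu02def, hAA, ht0, ht2]; norm_num
  have hA10 : ⁅T', ⁅T', u10⁆⁆ = (4 : ℂ) • u10 := by rw [hu10def, hAA, ht0, ht1]; norm_num
  have hA20 : ⁅T', ⁅T', u20⁆⁆ = (4 : ℂ) • u20 := by rw [hu20def, hAA, ht0, ht2]; norm_num
  have hAz : ∀ z : 𝔏, ∃ c : Fin 3 → Fin 3 → ℂ,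
      ⁅T', ⁅T', z⁆⁆ = (4 : ℂ) • (c 0 1 • u01 + c 0 2 • u02 + c 1 0 • u10 + c 2 0 • u20) := by
    intro z
    obtain ⟨α, β, γ, c, hz, -⟩ := hstruct z z.2
    refine ⟨c, Subtype.ext ?_⟩
    rw [hbr𝔏, hbr𝔏]
    change Td * (Td * (z : Module.End ℂ W) - z * Td) - (Td * z - z * Td) * Td =
      (4 : ℂ) • (c 0 1 • u 0 1 + c 0 2 • u 0 2 + c 1 0 • u 1 0 + c 2 0 • u 2 0)
    rw [hz, hTdX, hTdX' α β γ]
  have hκTT : κ T' T' = 16 := by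
    -- `B := ¼ (ad T′)²` is a projection onto `S₄`
    let B : 𝔏 →ₗ[ℂ] 𝔏 := (4 : ℂ)⁻¹ • (LieAlgebra.ad ℂ 𝔏 T' ∘ₗ LieAlgebra.ad ℂ 𝔏 T')
    have hBapply : ∀ z : 𝔏, B z = (4 : ℂ)⁻¹ • ⁅T', ⁅T', z⁆⁆ := fun z => rfl
    have hproj : LinearMap.IsProj S₄ B := by
      constructor
      · intro z
        obtain ⟨c, hc⟩ := hAz z
        rw [hBapply, hc, smul_smul, inv_mul_cancel₀ (by norm_num : (4 : ℂ) ≠ 0), one_smul]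
        exact S₄.add_mem (S₄.add_mem (S₄.add_mem (S₄.smul_mem _ hm0) (S₄.smul_mem _ hm1)) (S₄.smul_mem _ hm2))
          (S₄.smul_mem _ hm3)
      · intro z hz
        obtain ⟨cf, hcf⟩ := (Submodule.mem_span_range_iff_exists_fun ℂ).1 hz
        rw [Fin.sum_univ_four] at hcf
        simp only [Matrix.cons_val_zero, Matrix.cons_val_one, Matrix.head_cons, Matrix.cons_val_two, Matrix.tail_cons,
          Matrix.cons_val_three] at hcf
        rw [← hcf, hBapply]
        simp only [lie_add, lie_smul, hA01, hA02, hA10, hA20, smul_add, smul_smul, mul_comm (4 : ℂ)⁻¹,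
          mul_inv_cancel_right₀ (by norm_num : (4 : ℂ) ≠ 0)]
    have htrB : LinearMap.trace ℂ 𝔏 B = 4 := by rw [hproj.trace, hfinS₄]; norm_num
    have htrA : LinearMap.trace ℂ 𝔏 (LieAlgebra.ad ℂ 𝔏 T' ∘ₗ LieAlgebra.ad ℂ 𝔏 T') = 16 := by
      have h4 : LieAlgebra.ad ℂ 𝔏 T' ∘ₗ LieAlgebra.ad ℂ 𝔏 T' = (4 : ℂ) • B := by
        change _ = (4 : ℂ) • ((4 : ℂ)⁻¹ • _)
        rw [smul_smul, mul_inv_cancel₀ (by norm_num : (4 : ℂ) ≠ 0), one_smul]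
      rw [h4, map_smul, htrB, smul_eq_mul]; norm_num
    rw [hκdef, killingForm_apply_apply]
    exact htrA
  -- §I the values `κ(u_ij, u_ji) = 6`
  have hbr_u : ∀ (i j k l : Fin 3) (h1 : u i j ∈ 𝔏) (h2 : u k l ∈ 𝔏),
      ((⁅(⟨u i j, h1⟩ : 𝔏), (⟨u k l, h2⟩ : 𝔏)⁆ : 𝔏) : Module.End ℂ W) =
        (if j = k then u i l else 0) - (if l = i then u k j else 0) := by
    intro i j k l h1 h2; rw [hbr𝔏]; change u i j * u k l - u k l * u i j = _; rw [hu, hu]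
  have hd01 : ⁅u01, u10⁆ = d01 := Subtype.ext (by rw [hbr_u]; change _ = u 0 0 - u 1 1; simp)
  have hd12' : ⁅u12, u21⁆ = d12 := Subtype.ext (by rw [hbr_u]; change _ = u 1 1 - u 2 2; simp)
  have hd02' : ⁅u02, u20⁆ = d02 := Subtype.ext (by rw [hbr_u]; change _ = u 0 0 - u 2 2; simp)
  have hT'eq : T' = (4 / 3 : ℂ) • d01 + (2 / 3 : ℂ) • d12 := Subtype.ext (by
    change Td = (4 / 3 : ℂ) • (u 0 0 - u 1 1) + (2 / 3 : ℂ) • (u 1 1 - u 2 2); exact hTdeq)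
  -- named weights under `ad T′` and `ad S′`
  have hT01 : ⁅T', u01⁆ = (2 : ℂ) • u01 := by rw [hu01def, hTu, ht0, ht1]; norm_num
  have hT02 : ⁅T', u02⁆ = (2 : ℂ) • u02 := by rw [hu02def, hTu, ht0, ht2]; norm_num
  have hT10 : ⁅T', u10⁆ = (-2 : ℂ) • u10 := by rw [hu10def, hTu, ht0, ht1]; norm_num
  have hT12 : ⁅T', u12⁆ = (0 : ℂ) • u12 := by rw [hu12def, hTu, ht1, ht2]; norm_num
  have hT20 : ⁅T', u20⁆ = (-2 : ℂ) • u20 := by rw [hu20def, hTu, ht0, ht2]; norm_num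
  have hT21 : ⁅T', u21⁆ = (0 : ℂ) • u21 := by rw [hu21def, hTu, ht1, ht2]; norm_num
  have hTd02 : ⁅T', d02⁆ = (0 : ℂ) • d02 := by rw [hd02def, hTd]
  have hTd12 : ⁅T', d12⁆ = (0 : ℂ) • d12 := by rw [hd12def, hTd]
  have hS01 : ⁅S', u01⁆ = (-1 : ℂ) • u01 := by rw [hu01def, hSu, hs0, hs1]; norm_num
  have hS02 : ⁅S', u02⁆ = (1 : ℂ) • u02 := by rw [hu02def, hSu, hs0, hs2]; norm_num
  have hS10 : ⁅S', u10⁆ = (1 : ℂ) • u10 := by rw [hu10def, hSu, hs0, hs1]; norm_num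
  have hS20 : ⁅S', u20⁆ = (-1 : ℂ) • u20 := by rw [hu20def, hSu, hs0, hs2]; norm_num
  have hk01 : κ u10 u01 = 6 := by
    have h1 : κ T' d01 = 2 * κ u10 u01 := by
      rw [hsymm, ← hd01, hinv, ← lie_skew u01 T', map_neg, neg_neg, hT01, map_smul, smul_eq_mul]
    have h2 : κ T' d12 = 0 := by
      rw [hsymm, ← hd12', hinv, ← lie_skew u12 T', map_neg, hT12, zero_smul, map_zero]; simp
    have h3 : κ T' T' = κ T' ((4 / 3 : ℂ) • d01 + (2 / 3 : ℂ) • d12) := by rw [← hT'eq]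
    have h := hκTT
    rw [h3, map_add, map_smul, map_smul, smul_eq_mul, smul_eq_mul, h1, h2] at h
    linear_combination (3 / 8 : ℂ) * h
  have hk10 : κ u01 u10 = 6 := by rw [hsymm]; exact hk01
  -- brackets of `u₀₁, u₀₂, u₁₂` with the diagonal elements
  have hbr_ud : ∀ (i j a b : Fin 3) (h1 : u i j ∈ 𝔏) (h2 : u a a - u b b ∈ 𝔏),
      ((⁅(⟨u i j, h1⟩ : 𝔏), (⟨u a a - u b b, h2⟩ : 𝔏)⁆ : 𝔏) : Module.End ℂ W) =
        ((if j = a then u i a else 0) - (if j = b then u i b else 0)) -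
        ((if a = i then u a j else 0) - (if b = i then u b j else 0)) := by
    intro i j a b h1 h2; rw [hbr𝔏]; change u i j * (u a a - u b b) - (u a a - u b b) * u i j = _
    rw [mul_sub, sub_mul, hu, hu, hu, hu]
  have hk02 : κ u20 u02 = 6 := by
    have ha : κ d01 d02 = 6 := by
      rw [← hd01, hinv]
      have hb : ⁅u01, d02⁆ = -u01 := Subtype.ext (by
        rw [hbr_ud]; change _ = -(u 0 1 : Module.End ℂ W); simp)
      rw [hb, map_neg, neg_neg, hk01]
    have hb : κ d01 d02 = κ u20 u02 := by
      rw [hsymm, ← hd02', hinv]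
      have hc : ⁅u02, d01⁆ = -u02 := Subtype.ext (by
        rw [hbr_ud]; change _ = -(u 0 2 : Module.End ℂ W); simp)
      rw [hc, map_neg, neg_neg]
    rw [← hb, ha]
  have hk20 : κ u02 u20 = 6 := by rw [hsymm]; exact hk02
  have hk12 : κ u21 u12 = 6 := by
    have ha : κ d01 d12 = -6 := by
      rw [← hd01, hinv]
      have hb : ⁅u01, d12⁆ = u01 := Subtype.ext (by
        rw [hbr_ud]; change _ = (u 0 1 : Module.End ℂ W); simp)
      rw [hb, hk01]
    have hb : κ d01 d12 = -κ u21 u12 := by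
      rw [hsymm, ← hd12', hinv]
      have hc : ⁅u12, d01⁆ = u12 := Subtype.ext (by
        rw [hbr_ud]; change _ = (u 1 2 : Module.End ℂ W); simp)
      rw [hc]
    rw [hb] at ha
    linear_combination -ha
  have hk21 : κ u12 u21 = 6 := by rw [hsymm]; exact hk12
  -- §J the zero table (weights under `ad T′`, `ad S′`)
  have hz0210 : κ u02 u10 = 0 := hweight S' u02 u10 1 1 hS02 hS10 (by norm_num)
  have hz1010 : κ u10 u10 = 0 := hweight T' u10 u10 (-2) (-2) hT10 hT10 (by norm_num)
  have hz1210 : κ u12 u10 = 0 := hweight T' u12 u10 0 (-2) hT12 hT10 (by norm_num)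
  have hz2010 : κ u20 u10 = 0 := hweight T' u20 u10 (-2) (-2) hT20 hT10 (by norm_num)
  have hz2110 : κ u21 u10 = 0 := hweight T' u21 u10 0 (-2) hT21 hT10 (by norm_num)
  have hzd0210 : κ d02 u10 = 0 := hweight T' d02 u10 0 (-2) hTd02 hT10 (by norm_num)
  have hzd1210 : κ d12 u10 = 0 := hweight T' d12 u10 0 (-2) hTd12 hT10 (by norm_num)
  have hz0120 : κ u01 u20 = 0 := hweight S' u01 u20 (-1) (-1) hS01 hS20 (by norm_num)
  have hz1020 : κ u10 u20 = 0 := hweight T' u10 u20 (-2) (-2) hT10 hT20 (by norm_num)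
  have hz1220 : κ u12 u20 = 0 := hweight T' u12 u20 0 (-2) hT12 hT20 (by norm_num)
  have hz2020 : κ u20 u20 = 0 := hweight T' u20 u20 (-2) (-2) hT20 hT20 (by norm_num)
  have hz2120 : κ u21 u20 = 0 := hweight T' u21 u20 0 (-2) hT21 hT20 (by norm_num)
  have hzd0220 : κ d02 u20 = 0 := hweight T' d02 u20 0 (-2) hTd02 hT20 (by norm_num)
  have hzd1220 : κ d12 u20 = 0 := hweight T' d12 u20 0 (-2) hTd12 hT20 (by norm_num)
  have hz0201 : κ u02 u01 = 0 := hweight T' u02 u01 2 2 hT02 hT01 (by norm_num)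
  have hz2001 : κ u20 u01 = 0 := hweight S' u20 u01 (-1) (-1) hS20 hS01 (by norm_num)
  have hz1201 : κ u12 u01 = 0 := hweight T' u12 u01 0 2 hT12 hT01 (by norm_num)
  have hz2101 : κ u21 u01 = 0 := hweight T' u21 u01 0 2 hT21 hT01 (by norm_num)
  have hz0101 : κ u01 u01 = 0 := hweight T' u01 u01 2 2 hT01 hT01 (by norm_num)
  have hzd0201 : κ d02 u01 = 0 := hweight T' d02 u01 0 2 hTd02 hT01 (by norm_num)
  have hzd1201 : κ d12 u01 = 0 := hweight T' d12 u01 0 2 hTd12 hT01 (by norm_num)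
  have hz0102 : κ u01 u02 = 0 := hweight T' u01 u02 2 2 hT01 hT02 (by norm_num)
  have hz1002 : κ u10 u02 = 0 := hweight S' u10 u02 1 1 hS10 hS02 (by norm_num)
  have hz1202 : κ u12 u02 = 0 := hweight T' u12 u02 0 2 hT12 hT02 (by norm_num)
  have hz2102 : κ u21 u02 = 0 := hweight T' u21 u02 0 2 hT21 hT02 (by norm_num)
  have hz0202 : κ u02 u02 = 0 := hweight T' u02 u02 2 2 hT02 hT02 (by norm_num)
  have hzd0202 : κ d02 u02 = 0 := hweight T' d02 u02 0 2 hTd02 hT02 (by norm_num)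
  have hzd1202 : κ d12 u02 = 0 := hweight T' d12 u02 0 2 hTd12 hT02 (by norm_num)
  -- §K traces against `H = p₀₀ − p₁₁` and the `p`-part of `κ`
  have htrEp : LinearMap.trace ℂ W Ep = 0 := by rw [hEpdef, htrp, if_neg h01]
  have htrFp : LinearMap.trace ℂ W Fp = 0 := by rw [hFpdef, htrp, if_neg h10]
  have htrHu : ∀ i j, LinearMap.trace ℂ W (H * u i j) = 0 := by
    intro i j
    rw [hHdef, sub_mul, map_sub, htrpu, htrpu]
    by_cases hij : i = j
    · simp [hij]
    · simp [hij]
  have htrHS : ∀ c : Fin 3 → Fin 3 → ℂ, LinearMap.trace ℂ W (H * ∑ i, ∑ j, c i j • u i j) = 0 := by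
    intro c
    rw [Finset.mul_sum, map_sum]
    refine Finset.sum_eq_zero fun i _ => ?_
    rw [Finset.mul_sum, map_sum]
    refine Finset.sum_eq_zero fun j _ => ?_
    rw [mul_smul_comm, map_smul, htrHu, smul_zero]
  have hSp : ∀ (c : Fin 3 → Fin 3 → ℂ) (a b : Fin 2),
      (∑ i, ∑ j, c i j • u i j) * p a b = p a b * ∑ i, ∑ j, c i j • u i j := by
    intro c a b
    rw [Finset.sum_mul, Finset.mul_sum]
    refine Finset.sum_congr rfl fun i _ => ?_
    rw [Finset.sum_mul, Finset.mul_sum]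
    refine Finset.sum_congr rfl fun j _ => ?_
    rw [smul_mul_assoc, mul_smul_comm, hup]
  have hSu_mul : ∀ (c : Fin 3 → Fin 3 → ℂ) (l k : Fin 3),
      (∑ i, ∑ j, c i j • u i j) * u l k = ∑ i, c i l • u i k := by
    intro c l k
    rw [Finset.sum_mul]
    refine Finset.sum_congr rfl fun i _ => ?_
    rw [Finset.sum_mul]
    simp only [smul_mul_assoc, hu, smul_ite, smul_zero, Finset.sum_ite_eq', Finset.mem_univ,
      if_true]
  have hκHu : ∀ (l k : Fin 3) (h : u l k ∈ 𝔏), κ H' ⟨u l k, h⟩ = 0 := fun l k h =>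
    hκab H' ⟨u l k, h⟩ (fun i j => hHu i j) (fun c d => hup l k c d) (hHu l k)
  have hκEu : ∀ (l k : Fin 3) (h : u l k ∈ 𝔏), κ E' ⟨u l k, h⟩ = 0 := fun l k h =>
    hκab E' ⟨u l k, h⟩ (fun i j => hEu i j) (fun c d => hup l k c d) (hEu l k)
  have hκFu : ∀ (l k : Fin 3) (h : u l k ∈ 𝔏), κ F' ⟨u l k, h⟩ = 0 := fun l k h =>
    hκab F' ⟨u l k, h⟩ (fun i j => hFu i j) (fun c d => hup l k c d) (hFu l k)
  have hH'ne : H' ≠ 0 := by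
    intro h
    have h' : H = 0 := congrArg Subtype.val h
    have h2 : p 0 0 * H = p 0 0 := by rw [hHdef, mul_sub, hp, hp, if_pos rfl, if_neg h01, sub_zero]
    rw [h', mul_zero] at h2
    exact hp0 0 0 h2.symm
  -- the structure of an element of `𝔏` relative to the named basis
  have hdecomp : ∀ R : 𝔏, ∃ (α β γ : ℂ) (c : Fin 3 → Fin 3 → ℂ) (B : 𝔏),
      R = α • H' + β • E' + γ • F' + B ∧ (B : Module.End ℂ W) = ∑ i, ∑ j, c i j • u i j ∧
      (R : Module.End ℂ W) = α • H + β • Ep + γ • Fp + ∑ i, ∑ j, c i j • u i j ∧ ∑ i, c i i = 0 := by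
    intro R
    obtain ⟨α, β, γ, c, hR', hcsum⟩ := hstruct R.1 R.2
    refine ⟨α, β, γ, c, R - (α • H' + β • E' + γ • F'), by abel, ?_, hR', hcsum⟩
    change (R : Module.End ℂ W) - (α • H + β • Ep + γ • Fp) = _
    rw [hR']; abel
  refine ⟨H', hH'ne, fun Y => ?_, fun R hR => ?_⟩
  · -- `tr_W(H·Y) = ¾ κ(H, Y)`
    obtain ⟨α, β, γ, c, B, hYdec, hBval, hY, -⟩ := hdecomp Y
    have hBp : ∀ a b, (B : Module.End ℂ W) * p a b = p a b * B := by intro a b; rw [hBval]; exact hSp c a b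
    have hHB : (H' : Module.End ℂ W) * B = B * H' := by
      change H * (B : Module.End ℂ W) = B * H; rw [hBval]; exact (husumH c).symm
    have hκHB : κ H' B = 0 := hκab H' B (fun i j => hHu i j) hBp hHB
    have hκHY : κ H' Y = 8 * α := by
      rw [hYdec, map_add, map_add, map_add, map_smul, map_smul, map_smul, smul_eq_mul, smul_eq_mul, smul_eq_mul,
        hκHH, hκHE, hκHF, hκHB]; ring
    have htrHY : LinearMap.trace ℂ W (H * (Y : Module.End ℂ W)) = 6 * α := by
      rw [hY, mul_add, mul_add, mul_add, map_add, map_add, map_add, mul_smul_comm, mul_smul_comm, mul_smul_comm,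
        map_smul, map_smul, map_smul, hHH, hHEm, hHFm, map_neg, htr1, htrEp, htrFp, htrHS]
      simp only [smul_eq_mul, mul_zero, neg_zero, add_zero]; ring
    change LinearMap.trace ℂ W (H * (Y : Module.End ℂ W)) = (3 / 4 : ℂ) * κ H' Y
    rw [htrHY, hκHY]; ring
  · -- the radical commutes with `T = u₀₀ − u₁₁ − u₂₂`
    obtain ⟨α, β, γ, c, B, hRdec, hBval, hR', hcsum⟩ := hdecomp R
    have hc22 : c 2 2 = -c 0 0 - c 1 1 := by
      rw [Fin.sum_univ_three] at hcsum; linear_combination hcsum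
    have hBeq : B = c 0 1 • u01 + c 0 2 • u02 + c 1 0 • u10 + c 1 2 • u12 + c 2 0 • u20 + c 2 1 • u21 +
        c 0 0 • d02 + c 1 1 • d12 := by
      apply Subtype.ext
      rw [hBval]
      change ∑ i, ∑ j, c i j • u i j = c 0 1 • u 0 1 + c 0 2 • u 0 2 + c 1 0 • u 1 0 + c 1 2 • u 1 2 +
        c 2 0 • u 2 0 + c 2 1 • u 2 1 + c 0 0 • (u 0 0 - u 2 2) + c 1 1 • (u 1 1 - u 2 2)
      rw [Fin.sum_univ_three, Fin.sum_univ_three, Fin.sum_univ_three, Fin.sum_univ_three, hc22]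
      module
    -- trace side: `tr_W(R · u_lk) = 2 c_kl`
    have httr : ∀ l k : Fin 3, LinearMap.trace ℂ W ((R : Module.End ℂ W) * u l k) = 2 * c k l := by
      intro l k
      rw [hR', add_mul, add_mul, add_mul, map_add, map_add, map_add, smul_mul_assoc, smul_mul_assoc, smul_mul_assoc,
        map_smul, map_smul, map_smul, htrHu, hSu_mul, map_sum]
      have hE0 : LinearMap.trace ℂ W (Ep * u l k) = 0 := by
        rw [hEpdef, htrpu]; simp [h01]
      have hF0 : LinearMap.trace ℂ W (Fp * u l k) = 0 := by
        rw [hFpdef, htrpu]; simp [h10]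
      rw [hE0, hF0]
      simp only [map_smul, htru, smul_eq_mul, mul_ite, mul_zero, Finset.sum_ite_eq',
        Finset.mem_univ, if_true, zero_add]
      ring
    -- `κ` side: `κ(R, u_lk) = 6 c_kl` for the four `𝔪`-roots
    have hκR : ∀ y : 𝔏, κ H' y = 0 → κ E' y = 0 → κ F' y = 0 → κ R y = κ B y := by
      intro y h1 h2 h3
      rw [hRdec, map_add, map_add, map_add, map_smul, map_smul, map_smul, LinearMap.add_apply, LinearMap.add_apply,
        LinearMap.add_apply, LinearMap.smul_apply, LinearMap.smul_apply, LinearMap.smul_apply, h1, h2, h3]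
      simp
    have hκB : ∀ y : 𝔏, κ B y = c 0 1 * κ u01 y + c 0 2 * κ u02 y + c 1 0 * κ u10 y + c 1 2 * κ u12 y +
        c 2 0 * κ u20 y + c 2 1 * κ u21 y + c 0 0 * κ d02 y + c 1 1 * κ d12 y := by
      intro y
      rw [hBeq]
      simp only [map_add, map_smul, LinearMap.add_apply, LinearMap.smul_apply, smul_eq_mul]
    have hc01 : c 0 1 = 0 := by
      have h := hR u10
      have e1 : LinearMap.trace ℂ W ((R : Module.End ℂ W) * (u10 : Module.End ℂ W)) = 2 * c 0 1 := httr 1 0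
      rw [e1, hκR u10 (hκHu 1 0 _) (hκEu 1 0 _) (hκFu 1 0 _), hκB, hk10, hz0210, hz1010, hz1210, hz2010, hz2110,
        hzd0210, hzd1210] at h
      linear_combination (-2 / 5 : ℂ) * h
    have hc02 : c 0 2 = 0 := by
      have h := hR u20
      have e1 : LinearMap.trace ℂ W ((R : Module.End ℂ W) * (u20 : Module.End ℂ W)) = 2 * c 0 2 := httr 2 0
      rw [e1, hκR u20 (hκHu 2 0 _) (hκEu 2 0 _) (hκFu 2 0 _), hκB, hk20, hz0120, hz1020, hz1220, hz2020, hz2120,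
        hzd0220, hzd1220] at h
      linear_combination (-2 / 5 : ℂ) * h
    have hc10 : c 1 0 = 0 := by
      have h := hR u01
      have e1 : LinearMap.trace ℂ W ((R : Module.End ℂ W) * (u01 : Module.End ℂ W)) = 2 * c 1 0 := httr 0 1
      rw [e1, hκR u01 (hκHu 0 1 _) (hκEu 0 1 _) (hκFu 0 1 _), hκB, hk01, hz0201, hz2001, hz1201, hz2101, hz0101,
        hzd0201, hzd1201] at h
      linear_combination (-2 / 5 : ℂ) * h
    have hc20 : c 2 0 = 0 := by
      have h := hR u02
      have e1 : LinearMap.trace ℂ W ((R : Module.End ℂ W) * (u02 : Module.End ℂ W)) = 2 * c 2 0 := httr 0 2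
      rw [e1, hκR u02 (hκHu 0 2 _) (hκEu 0 2 _) (hκFu 0 2 _), hκB, hk02, hz0102, hz1002, hz1202, hz2102, hz0202,
        hzd0202, hzd1202] at h
      linear_combination (-2 / 5 : ℂ) * h
    -- conclusion: `[R, T] = 0`
    have hτ : u 0 0 - u 1 1 - u 2 2 = ∑ k, (fun k : Fin 3 => if k = 0 then (1 : ℂ) else -1) k • u k k := by
      rw [Fin.sum_univ_three]
      simp only [if_true, if_neg (show (1 : Fin 3) ≠ 0 from by decide), if_neg (show (2 : Fin 3) ≠ 0 from by decide)]
      module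
    have hXS : (∑ k, (fun k : Fin 3 => if k = 0 then (1 : ℂ) else -1) k • u k k) * (∑ i, ∑ j, c i j • u i j) =
        (∑ i, ∑ j, c i j • u i j) * ∑ k, (fun k : Fin 3 => if k = 0 then (1 : ℂ) else -1) k • u k k := by
      rw [← sub_eq_zero, hdiagsum]
      simp only [Fin.sum_univ_three, hc01, hc02, hc10, hc20, if_neg (show (1 : Fin 3) ≠ 0 from by decide),
        if_neg (show (2 : Fin 3) ≠ 0 from by decide), sub_self, mul_zero, zero_mul, zero_smul, add_zero]
    have hHT : H * (u 0 0 - u 1 1 - u 2 2) = (u 0 0 - u 1 1 - u 2 2) * H := by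
      rw [hτ, hHdef, sub_mul, mul_sub, ← hdiagp, ← hdiagp]
    have hET : Ep * (u 0 0 - u 1 1 - u 2 2) = (u 0 0 - u 1 1 - u 2 2) * Ep := by rw [hτ, hEpdef, ← hdiagp]
    have hFT : Fp * (u 0 0 - u 1 1 - u 2 2) = (u 0 0 - u 1 1 - u 2 2) * Fp := by rw [hτ, hFpdef, ← hdiagp]
    have hST : (∑ i, ∑ j, c i j • u i j) * (u 0 0 - u 1 1 - u 2 2) =
        (u 0 0 - u 1 1 - u 2 2) * ∑ i, ∑ j, c i j • u i j := by rw [hτ, hXS]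
    rw [hR', add_mul, add_mul, add_mul, mul_add, mul_add, mul_add, smul_mul_assoc, smul_mul_assoc, smul_mul_assoc,
      mul_smul_comm, mul_smul_comm, mul_smul_comm, hHT, hET, hFT, hST]

end HodgeStructure

end Literature.AlgebraicGeometry.Motives

end
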